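import Summits.HodgeConjecture.HodgeConjecture.Theorems.F0P3cStCharTSHorient        -- ★ p849911 HORIENT: `E₃`-readings of rays ∕ flips, `horient_antiShell`; brings KIT-B tokens (`endoEmbLocal`, `IsLocalGRegular`)
import Summits.HodgeConjecture.HodgeConjecture.Theorems.F0P3cStCharTSK0WeylG        -- ★ (A-p16) K0-WEYL-G: `exists_weylElt_mem_and_forall_mul_mul_inv_mem_three`, `coe_localNonsplitEquiv_weylElt_three`
import Summits.HodgeConjecture.HodgeConjecture.Theorems.F0P3cStCharTSCosetCover     -- ★ p849867 COSET-COVER: `exists_cosetCover`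
import Summits.HodgeConjecture.HodgeConjecture.Theorems.F0P3cStCharTSHtauOnCoset    -- ★ p849908 HTAU-ON-COSET (this seat): the box antecedent text
import Literature.NumberTheory.Automorphic.CMBorelWeylTorusConjugate                 -- ★ `weylConj_mem_cmTorus` (`w₀ t w₀⁻¹ ∈ T`)
import Literature.NumberTheory.Automorphic.CMBorelIwahoriShellBound                  -- ★ `isClosed_cmBorelTriple_M`
import HarnessLib

/-!
# F0 · P3c · line LH6 «StCharTS» — road (D) «DEEP-FL», «XIG-DATA★»: the data glue of the XIG-ASSEMBLY head — the shell group `S_n`, the oriented base `b′ = ʷ(z aᵐ)`,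
# the coset cover `F`, and their checklist properties in the binder names of ★ p849876 ∕ ★ p850018

Cell `pub/hodgecm-mathlib`, crux H413 = `stmt-HodgeConjecture-24833` (lane `--supports … --as helper`), route HCCMUnconditional; seat LH6-p03 (g2); dealt BY NAME by the road (D)
owner LH6-p04 (g3) 2026-09-02T06:59:51Z; census `F0/P3b/LH6-p03/g2/CENSUS-XIG-DATA.v1.md` (29a01dae02a4f9f0).  THEOREMS ONLY, sorry-free, ★-only imports; no definition ∕ instance ∕
notation ∕ named fact.  HONEST LABEL: HC_CM is proved only modulo the 7 printed citations (2 remaining: hLiu418 = stmt-HodgeConjecture-24832, h413 = stmt-HodgeConjecture-24833)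
until rung 0 closes; count-neutral plumbing of road (D).

THE MATHEMATICS ([Rogawski1990, §4.9 Lemma 4.9.2 p. 56; §12.7 L. 12.7.3 (proof) p. 195]).  The XIG shell is `K_n b K_n`, `b = z·𝓘.aᵐ` (`E₃ z = β·1`, `E₃ 𝓘.a = d(α, 1, (σ_w α)⁻¹)`,
`|α|_w < 1`).  Its torus trace `S_n := T₃ ∩ K_n` is a compact subgroup of `T₃`; the Levi stratum of `hlevi` meets the Weyl-FLIPPED base `b′ := w₀ b w₀⁻¹ ∈ T₃` (`w₀ ∈ K₀` the long
Weyl element, ★ K0-WEYL-G), whose one-place matrix is `E₃ b′ = d(β(σ_w α)⁻ᵐ, β, β αᵐ)` (first entry LARGE) — the `b₂` shape of ★ HORIENT `valued_lt_of_endoEmbLocal_eq_flip_mul`.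
§1 `S_n`; §2 `b′`; §3 the cover `F` of `Ψ₀⁻¹(b′·S_n)` by `S′`-cosets (★ COSET-COVER) packaged with (a)–(d) of the census.

## References
* [Rogawski1990] J. D. Rogawski, *Automorphic Representations of Unitary Groups in Three Variables*, Ann. of Math. Stud. 123 (1990): §4.9 Lemma 4.9.2 p. 56; §12.7
  Lemma 12.7.3 (proof) p. 195; §1.10 p. 9.
* [Casselman1995] W. Casselman, *Introduction to the theory of admissible representations of p-adic reductive groups* (1995): §1.4 Prop. 1.4.4 p. 14.
-/

set_option autoImplicit false
-- the mandated namespace has the single-problem summit's repeated segment (`HodgeConjecture.HodgeConjecture`)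
set_option linter.dupNamespace false

noncomputable section

open Matrix NumberField IsDedekindDomain Topology Filter
open scoped MatrixGroups Pointwise
open Literature.NumberTheory.Rogawski1990 Literature.NumberTheory.Automorphic Literature.NumberTheory.Automorphic.UnitaryGroup
open Literature.NumberTheory.GaloisRepresentations
open Literature.NumberTheory (Rogawski1990.qsForm)

namespace Summit.HodgeConjecture.HodgeConjecture.Cruxes.H413.F0P3cStCharTSXIGData

variable (L : Type) [Field L] [NumberField L] [IsCMField L] (v : HeightOneSpectrum (𝓞 ↥(maximalRealSubfield L)))
  (w : PlacesOver L v) (hw : IsCMField.complexConj L • w.1 = w.1)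

/-! ## §1 The shell group `S_n = T₃ ∩ K_n` -/

/-- Membership in `S_n := K_n ∩ T₃` read on `U(Φ₃)(L⁺_v)`. [cite: Casselman1995, §1.4 Prop. 1.4.4 p. 14] -/
theorem mem_shellGroup_iff (Kn : Subgroup ↥(unitaryGroupOfForm (conjLocal L (IsCMField.complexConj L) v) (cmLocalForm L 3 v)))
    (s : ↥(cmBorelTriple L 3 v).M) :
    s ∈ Kn.subgroupOf (cmBorelTriple L 3 v).M ↔ (s : ↥(unitaryGroupOfForm (conjLocal L (IsCMField.complexConj L) v) (cmLocalForm L 3 v))) ∈ Kn :=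
  Subgroup.mem_subgroupOf

/-- **`S_n` is compact**: `T₃` is closed (★ `isClosed_cmBorelTriple_M`), `K_n` is compact. [cite: Casselman1995, §1.4 Prop. 1.4.4 p. 14] -/
theorem isCompact_shellGroup (Kn : Subgroup ↥(unitaryGroupOfForm (conjLocal L (IsCMField.complexConj L) v) (cmLocalForm L 3 v)))
    (hKc : IsCompact (Kn : Set ↥(unitaryGroupOfForm (conjLocal L (IsCMField.complexConj L) v) (cmLocalForm L 3 v)))) :
    IsCompact ((Kn.subgroupOf (cmBorelTriple L 3 v).M : Subgroup ↥(cmBorelTriple L 3 v).M) : Set ↥(cmBorelTriple L 3 v).M) := by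
  have hce : Topology.IsClosedEmbedding (Subtype.val : ↥(cmBorelTriple L 3 v).M → ↥(unitaryGroupOfForm (conjLocal L (IsCMField.complexConj L) v) (cmLocalForm L 3 v))) :=
    Topology.IsClosedEmbedding.subtypeVal (isClosed_cmBorelTriple_M L v)
  have h := hce.isCompact_preimage hKc
  rw [Subgroup.coe_subgroupOf]
  exact h

/-- A character trivial on `K_n ∩ T₃` (read through a hypothesis on `K_n`) is trivial on `S_n` (the (R5) input `hSn` of ★ p850018). [cite: Rogawski1990, §12.7 L. 12.7.3 (proof) p. 195] -/
theorem forall_shellGroup_apply_eq_one (Kn : Subgroup ↥(unitaryGroupOfForm (conjLocal L (IsCMField.complexConj L) v) (cmLocalForm L 3 v)))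
    {M : Type*} [Monoid M] (χ : ↥(cmBorelTriple L 3 v).M →* M)
    (hχ : ∀ t : ↥(cmBorelTriple L 3 v).M, (t : ↥(unitaryGroupOfForm (conjLocal L (IsCMField.complexConj L) v) (cmLocalForm L 3 v))) ∈ Kn → χ t = 1) :
    ∀ t ∈ Kn.subgroupOf (cmBorelTriple L 3 v).M, χ t = 1 :=
  fun t ht => hχ t (Subgroup.mem_subgroupOf.1 ht)

/-! ## §2 The oriented base `b′ = w₀ (z aᵐ) w₀⁻¹` -/

/-- `Φ₃ · d(a, b, c) · Φ₃ = d(c, b, a)` (conjugation by the antidiagonal reverses a diagonal; `Φ₃⁻¹ = Φ₃`). [cite: Rogawski1990, §1.10 p. 9] -/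
theorem antidiagonal_mul_diagonal_mul_antidiagonal_three {K : Type*} [CommRing K] (a b c : K) :
    (StdForm.antidiagonal 3).over K * Matrix.diagonal ![a, b, c] * (StdForm.antidiagonal 3).over K = Matrix.diagonal ![c, b, a] := by
  ext i j
  simp only [Matrix.mul_apply, Fin.sum_univ_three, StdForm.antidiagonal_over_apply, Matrix.diagonal_apply]
  fin_cases i <;> fin_cases j <;> simp [Fin.rev, Fin.ext_iff]

include hw in
/-- **THE FLIPPED BASE.**  For `(𝓘, K₀)` with the normalising and integrality clauses (5), (11) of the package, `z` with `E₃ z = β·1` and the ray `E₃ a = d(α, 1, (σ_w α)⁻¹)`: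
there are `w₀ ∈ K₀` normalising every `K_n` and `b′ ∈ T₃` with `↑b′ = w₀ (z aᵐ) w₀⁻¹` and `E₃ b′ = d(β(σ_w α)⁻ᵐ, β, β αᵐ)` — the ORIENTED base of the deep shell
(★ K0-WEYL-G `exists_weylElt_…_three`, ★ `weylConj_mem_cmTorus`, ★ HORIENT `localNonsplitEquiv_ray_mul_apply`-style matrix algebra). [cite: Rogawski1990, §1.10 p. 9; §12.7 L. 12.7.3 (proof) p. 195] -/
theorem exists_flipBase (hns : ∀ w' : PlacesOver L v, IsCMField.complexConj L • w'.1 = w'.1)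
    (𝓘 : (cmBorelTriple L 3 v).IwahoriDatum)
    (K₀ : Subgroup ↥(unitaryGroupOfForm (conjLocal L (IsCMField.complexConj L) v) (cmLocalForm L 3 v)))
    (hKK₀ : ∀ n, ∀ k ∈ K₀, ∀ κ ∈ 𝓘.K n, k⁻¹ * κ * k ∈ 𝓘.K n)
    (hK₀ : ∀ k : ↥(unitaryGroupOfForm (conjLocal L (IsCMField.complexConj L) v) (cmLocalForm L 3 v)), k ∈ K₀ ↔
      ((((localNonsplitEquiv (IsCMField.complexConj L) (Rogawski1990.qsForm L) (IsCMField.complexConj_ne_one L) w hw) k :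
        ↥(unitaryGroupOfForm (galAdicCompletionMap (L := L) (IsCMField.complexConj L) hw) (placeForm (Rogawski1990.qsForm L) w.1))) :
          GL (Fin 3) (w.1.adicCompletion L)) ∈ glInt 3 (w.1.adicCompletion L)))
    {z : ↥(unitaryGroupOfForm (conjLocal L (IsCMField.complexConj L) v) (cmLocalForm L 3 v))} {β α : w.1.adicCompletion L}
    (hz : (((localNonsplitEquiv (IsCMField.complexConj L) (qsForm L) (IsCMField.complexConj_ne_one L) w hw z :
        ↥(unitaryGroupOfForm (galAdicCompletionMap (L := L) (IsCMField.complexConj L) hw) (placeForm (qsForm L) w.1))) :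
        GL (Fin 3) (w.1.adicCompletion L)) : Matrix (Fin 3) (Fin 3) (w.1.adicCompletion L)) = β • (1 : Matrix (Fin 3) (Fin 3) (w.1.adicCompletion L)))
    (ha : (((localNonsplitEquiv (IsCMField.complexConj L) (qsForm L) (IsCMField.complexConj_ne_one L) w hw 𝓘.a :
        ↥(unitaryGroupOfForm (galAdicCompletionMap (L := L) (IsCMField.complexConj L) hw) (placeForm (qsForm L) w.1))) :
        GL (Fin 3) (w.1.adicCompletion L)) : Matrix (Fin 3) (Fin 3) (w.1.adicCompletion L)) =
        Matrix.diagonal ![α, 1, ((galAdicCompletionMap (L := L) (IsCMField.complexConj L) hw) α)⁻¹])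
    (m : ℕ) (hbM : z * 𝓘.a ^ m ∈ (cmBorelTriple L 3 v).M) :
    ∃ (w₀ : ↥(unitaryGroupOfForm (conjLocal L (IsCMField.complexConj L) v) (cmLocalForm L 3 v))) (b' : ↥(cmBorelTriple L 3 v).M),
      Units.val (w₀ : GL (Fin 3) (LocalRing L v)) = cmLocalForm L 3 v ∧ w₀ ∈ K₀ ∧ (∀ n, ∀ κ ∈ 𝓘.K n, w₀ * κ * w₀⁻¹ ∈ 𝓘.K n) ∧
      (b' : ↥(unitaryGroupOfForm (conjLocal L (IsCMField.complexConj L) v) (cmLocalForm L 3 v))) = w₀ * (z * 𝓘.a ^ m) * w₀⁻¹ ∧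
      (((localNonsplitEquiv (IsCMField.complexConj L) (qsForm L) (IsCMField.complexConj_ne_one L) w hw
          (b' : ↥(unitaryGroupOfForm (conjLocal L (IsCMField.complexConj L) v) (cmLocalForm L 3 v))) :
        ↥(unitaryGroupOfForm (galAdicCompletionMap (L := L) (IsCMField.complexConj L) hw) (placeForm (qsForm L) w.1))) :
        GL (Fin 3) (w.1.adicCompletion L)) : Matrix (Fin 3) (Fin 3) (w.1.adicCompletion L)) =
        Matrix.diagonal ![β * ((galAdicCompletionMap (L := L) (IsCMField.complexConj L) hw) α)⁻¹ ^ m, β, β * α ^ m] := by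
  obtain ⟨w₀, hw₀, hw₀K₀, hw₀n⟩ := F0P3cStCharTSK0WeylG.exists_weylElt_mem_and_forall_mul_mul_inv_mem_three L v w hw hns 𝓘 K₀ hKK₀ hK₀
  refine ⟨w₀, ⟨w₀ * (z * 𝓘.a ^ m) * w₀⁻¹, ?_⟩, hw₀, hw₀K₀, hw₀n, rfl, ?_⟩
  · exact weylConj_mem_cmTorus L v w₀ hw₀ ⟨z * 𝓘.a ^ m, hbM⟩
  · -- `w₀⁻¹ = w₀` (`Φ₃² = 1`); then everything is matrix algebra over `L_w` in `ev_w`-coordinates (★ `coe_localNonsplitEquiv_eq_map`, definitional):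
    -- `E₃ w₀ = Φ₃`, `E₃ (z aᵐ) = d(βαᵐ, β, β(σα)⁻ᵐ)`, and `Φ₃ d Φ₃` reverses the diagonal
    have hww : w₀ * w₀ = 1 := by
      apply Subtype.ext
      apply Units.ext
      rw [Subgroup.coe_mul, Units.val_mul, hw₀, Subgroup.coe_one, Units.val_one, cmLocalForm_eq_over, StdForm.over_mul_over]
    have hwinv : w₀⁻¹ = w₀ := inv_eq_of_mul_eq_one_right hww
    have hJ' : (((w₀.val : GL (Fin 3) (LocalRing L v)) : Matrix (Fin 3) (Fin 3) (LocalRing L v)).map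
        (Pi.evalRingHom (fun w' : PlacesOver L v => w'.1.adicCompletion L) w)) = (StdForm.antidiagonal 3).over (w.1.adicCompletion L) :=
      F0P3cStCharTSK0WeylG.coe_localNonsplitEquiv_weylElt_three L v w hw w₀ hw₀
    have hz' : (((z.val : GL (Fin 3) (LocalRing L v)) : Matrix (Fin 3) (Fin 3) (LocalRing L v)).map
        (Pi.evalRingHom (fun w' : PlacesOver L v => w'.1.adicCompletion L) w)) = β • (1 : Matrix (Fin 3) (Fin 3) (w.1.adicCompletion L)) := hz
    have ha' : (((𝓘.a.val : GL (Fin 3) (LocalRing L v)) : Matrix (Fin 3) (Fin 3) (LocalRing L v)).map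
        (Pi.evalRingHom (fun w' : PlacesOver L v => w'.1.adicCompletion L) w)) =
        Matrix.diagonal ![α, 1, ((galAdicCompletionMap (L := L) (IsCMField.complexConj L) hw) α)⁻¹] := ha
    have hray' : ((((z * 𝓘.a ^ m).val : GL (Fin 3) (LocalRing L v)) : Matrix (Fin 3) (Fin 3) (LocalRing L v)).map
        (Pi.evalRingHom (fun w' : PlacesOver L v => w'.1.adicCompletion L) w)) =
        Matrix.diagonal ![β * α ^ m, β, β * ((galAdicCompletionMap (L := L) (IsCMField.complexConj L) hw) α)⁻¹ ^ m] := by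
      rw [Subgroup.coe_mul, Subgroup.coe_pow, Units.val_mul, Units.val_pow_eq_pow_val, Matrix.map_mul, Matrix.map_pow, hz', ha',
        F0P3cStCharTSShellOrientation.diagonal_three_pow, smul_mul_assoc, one_mul, ← Matrix.diagonal_smul]
      congr 1
      funext i
      fin_cases i <;> simp
    have hb : w₀ * (z * 𝓘.a ^ m) * w₀⁻¹ = w₀ * (z * 𝓘.a ^ m) * w₀ := by rw [hwinv]
    dsimp only
    rw [hb, coe_localNonsplitEquiv_eq_map, Subgroup.coe_mul, Subgroup.coe_mul, Units.val_mul, Units.val_mul, Matrix.map_mul, Matrix.map_mul, hJ', hray']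
    exact antidiagonal_mul_diagonal_mul_antidiagonal_three _ _ _

/-! ## §3 `Ψ₀` maps the `H`-torus into `T₃`; the pick hypothesis gives `Ψ₀(S′) ⊆ S_n` -/

/-- `Ψ₀(x) = ι_v(↑x.1, x.2) ∈ T₃` for `x ∈ T₂ × U(Φ₁)_v` (★ `endoEmbLocal_eq_glDiagonal_of_fst_eq`). [cite: Rogawski1990, §4.9 p. 55] -/
theorem psi0_mem_torus (x : ↥(cmBorelTriple L 2 v).M × (cmDatum L 1 (Matrix.of fun i j : Fin 1 => if i.val + j.val + 1 = 1 then (1 : L) else 0)).Local v) :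
    endoEmbLocal L v ((x.1 : ↥(unitaryGroupOfForm (conjLocal L (IsCMField.complexConj L) v) (cmLocalForm L 2 v))), x.2) ∈ (cmBorelTriple L 3 v).M := by
  obtain ⟨d', hd'⟩ := (mem_torusU_iff _).1 x.1.2
  exact (mem_torusU_iff _).2 ⟨_, (endoEmbLocal_eq_glDiagonal_of_fst_eq L v
    ((x.1 : ↥(unitaryGroupOfForm (conjLocal L (IsCMField.complexConj L) v) (cmLocalForm L 2 v))), x.2) hd').symm⟩

/-- **`hΨ` of ★ COSET-COVER from the pick**: if `Ψ₀(k) ∈ K_n` for all `k ∈ S′` then `Ψ₀(k) ∈ S_n = K_n ∩ T₃` (as an element of `T₃`). [cite: Casselman1995, §1.4 Prop. 1.4.4 p. 14] -/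
theorem hPsi_of_pick (Kn : Subgroup ↥(unitaryGroupOfForm (conjLocal L (IsCMField.complexConj L) v) (cmLocalForm L 3 v)))
    (S' : Subgroup (↥(cmBorelTriple L 2 v).M × (cmDatum L 1 (Matrix.of fun i j : Fin 1 => if i.val + j.val + 1 = 1 then (1 : L) else 0)).Local v))
    (hpick : ∀ k ∈ S', endoEmbLocal L v ((k.1 : ↥(unitaryGroupOfForm (conjLocal L (IsCMField.complexConj L) v) (cmLocalForm L 2 v))), k.2) ∈ Kn) :
    ∀ k ∈ S', ∃ s ∈ Kn.subgroupOf (cmBorelTriple L 3 v).M,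
      endoEmbLocal L v ((k.1 : ↥(unitaryGroupOfForm (conjLocal L (IsCMField.complexConj L) v) (cmLocalForm L 2 v))), k.2) =
        ((s : ↥(cmBorelTriple L 3 v).M) : ↥(unitaryGroupOfForm (conjLocal L (IsCMField.complexConj L) v) (cmLocalForm L 3 v))) :=
  fun k hk => ⟨⟨_, psi0_mem_torus L v k⟩, Subgroup.mem_subgroupOf.2 (hpick k hk), rfl⟩

/-! ## §4 «XIG-DATA» — the shell package of the head over an `H`-level `S′` with `Ψ₀(S′) ⊆ K_n` -/

include hw in
set_option maxHeartbeats 1600000 in  -- statement-level `whnf` on the CM carriers + destructuring of the long ∃ (same class as ★ `exists_cosetCover`)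
/-- **«XIG-DATA★» (core, over an abstract `H`-level `S′`).**  Given the XIG binders (`𝓘`, level `n`, central `z` with `E₃ z = β·1`, the ray `E₃ 𝓘.a = d(α,1,(σ_w α)⁻¹)`,
`m`, `hbM`), the package clauses (5) ∕ (11) (`K₀` normalises the levels; `K₀ ↔ GL₃(𝒪_w)`), and an OPEN subgroup `S′ ≤ T₂ × U(Φ₁)_v` with `Ψ₀(S′) ⊆ K_n` (★ LEVEL-PICK-INST ∕
S-PRIME-DATA), there are `w₀`, the ORIENTED base `b′ ∈ T₃` and a finite `F ⊆ T₂ × U(Φ₁)_v` such that, with `S_n := K_n ∩ T₃` (`(𝓘.K n).subgroupOf T₃`): `w₀ ∈ K₀` is the long Weyl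
element normalising every `K_n`; `↑b′ = w₀ (z 𝓘.aᵐ) w₀⁻¹`, `E₃ b′ = d(β(σ_w α)⁻ᵐ, β, β αᵐ)` with `|β αᵐ|_w < |β(σ_w α)⁻ᵐ|_w` (REP-HYPERBOLIC's `hb′`∕`he`); `S_n` compact, `↑s ∈ K_n` on `S_n`
(REP-HYPERBOLIC's `hSn`), `Ψ₀(k) ∈ S_n` on `S′` (COSET-COVER's `hΨ`); and the four conjuncts of ★ `exists_cosetCover` VERBATIM at `(S_n, b′, S′, F)`: reps ON the shell (= `hrep` of ★
p850018), the cosets `u • S′` pairwise disjoint (= `hC` of ★ p849876), the COUNT identity `Ψ₀⁻¹(b′·S_n) = ⋃_{u∈F} u • S′` (for ★ HAAR-PSI ∕ `card_mul_measure_eq_of_cover`), and the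
graph-iff (⇒ `hcov`∕`hsub` of ★ p849876 by ★ (CC4)).  With `B₁ := {t | b⁻¹t ∈ {k | ↑k ∈ K_n}}` (★ HORIENT) and `B₂ := b′ • ↑S_n` these are the TRANSFER∕VALUE thirds' data.
[cite: Rogawski1990, §4.9 Lemma 4.9.2 p. 56; §12.7 Lemma 12.7.3 (proof) p. 195] [cite: Casselman1995, §1.4 Prop. 1.4.4 p. 14] -/
theorem exists_xigData (hns : ∀ w' : PlacesOver L v, IsCMField.complexConj L • w'.1 = w'.1)
    (𝓘 : (cmBorelTriple L 3 v).IwahoriDatum) (n : ℕ)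
    (K₀ : Subgroup ↥(unitaryGroupOfForm (conjLocal L (IsCMField.complexConj L) v) (cmLocalForm L 3 v)))
    (hKK₀ : ∀ n, ∀ k ∈ K₀, ∀ κ ∈ 𝓘.K n, k⁻¹ * κ * k ∈ 𝓘.K n)
    (hK₀ : ∀ k : ↥(unitaryGroupOfForm (conjLocal L (IsCMField.complexConj L) v) (cmLocalForm L 3 v)), k ∈ K₀ ↔
      ((((localNonsplitEquiv (IsCMField.complexConj L) (Rogawski1990.qsForm L) (IsCMField.complexConj_ne_one L) w hw) k :
        ↥(unitaryGroupOfForm (galAdicCompletionMap (L := L) (IsCMField.complexConj L) hw) (placeForm (Rogawski1990.qsForm L) w.1))) :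
          GL (Fin 3) (w.1.adicCompletion L)) ∈ glInt 3 (w.1.adicCompletion L)))
    {z : ↥(unitaryGroupOfForm (conjLocal L (IsCMField.complexConj L) v) (cmLocalForm L 3 v))} {β α : w.1.adicCompletion L}
    (hz : (((localNonsplitEquiv (IsCMField.complexConj L) (qsForm L) (IsCMField.complexConj_ne_one L) w hw z :
        ↥(unitaryGroupOfForm (galAdicCompletionMap (L := L) (IsCMField.complexConj L) hw) (placeForm (qsForm L) w.1))) :
        GL (Fin 3) (w.1.adicCompletion L)) : Matrix (Fin 3) (Fin 3) (w.1.adicCompletion L)) = β • (1 : Matrix (Fin 3) (Fin 3) (w.1.adicCompletion L)))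
    (hβ : Valued.v β = 1)
    (ha : (((localNonsplitEquiv (IsCMField.complexConj L) (qsForm L) (IsCMField.complexConj_ne_one L) w hw 𝓘.a :
        ↥(unitaryGroupOfForm (galAdicCompletionMap (L := L) (IsCMField.complexConj L) hw) (placeForm (qsForm L) w.1))) :
        GL (Fin 3) (w.1.adicCompletion L)) : Matrix (Fin 3) (Fin 3) (w.1.adicCompletion L)) =
        Matrix.diagonal ![α, 1, ((galAdicCompletionMap (L := L) (IsCMField.complexConj L) hw) α)⁻¹])
    (hα0 : α ≠ 0) (hα1 : Valued.v α < 1) {m : ℕ} (hm : 1 ≤ m) (hbM : z * 𝓘.a ^ m ∈ (cmBorelTriple L 3 v).M)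
    (S' : Subgroup (↥(cmBorelTriple L 2 v).M × (cmDatum L 1 (Matrix.of fun i j : Fin 1 => if i.val + j.val + 1 = 1 then (1 : L) else 0)).Local v))
    (hS' : IsOpen (S' : Set (↥(cmBorelTriple L 2 v).M × (cmDatum L 1 (Matrix.of fun i j : Fin 1 => if i.val + j.val + 1 = 1 then (1 : L) else 0)).Local v)))
    (hpick : ∀ k ∈ S', endoEmbLocal L v ((k.1 : ↥(unitaryGroupOfForm (conjLocal L (IsCMField.complexConj L) v) (cmLocalForm L 2 v))), k.2) ∈ 𝓘.K n) :
    ∃ (w₀ : ↥(unitaryGroupOfForm (conjLocal L (IsCMField.complexConj L) v) (cmLocalForm L 3 v))) (b' : ↥(cmBorelTriple L 3 v).M) (Sn : Subgroup ↥(cmBorelTriple L 3 v).M)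
      (F : Finset (↥(cmBorelTriple L 2 v).M × (cmDatum L 1 (Matrix.of fun i j : Fin 1 => if i.val + j.val + 1 = 1 then (1 : L) else 0)).Local v)),
      -- (a₀) the Weyl element
      Units.val (w₀ : GL (Fin 3) (LocalRing L v)) = cmLocalForm L 3 v ∧ w₀ ∈ K₀ ∧ (∀ n, ∀ κ ∈ 𝓘.K n, w₀ * κ * w₀⁻¹ ∈ 𝓘.K n) ∧
      -- (a₁) the oriented base
      (b' : ↥(unitaryGroupOfForm (conjLocal L (IsCMField.complexConj L) v) (cmLocalForm L 3 v))) = w₀ * (z * 𝓘.a ^ m) * w₀⁻¹ ∧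
      (((localNonsplitEquiv (IsCMField.complexConj L) (qsForm L) (IsCMField.complexConj_ne_one L) w hw
          (b' : ↥(unitaryGroupOfForm (conjLocal L (IsCMField.complexConj L) v) (cmLocalForm L 3 v))) :
        ↥(unitaryGroupOfForm (galAdicCompletionMap (L := L) (IsCMField.complexConj L) hw) (placeForm (qsForm L) w.1))) :
        GL (Fin 3) (w.1.adicCompletion L)) : Matrix (Fin 3) (Fin 3) (w.1.adicCompletion L)) =
        Matrix.diagonal ![β * ((galAdicCompletionMap (L := L) (IsCMField.complexConj L) hw) α)⁻¹ ^ m, β, β * α ^ m] ∧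
      Valued.v (β * α ^ m) < Valued.v (β * ((galAdicCompletionMap (L := L) (IsCMField.complexConj L) hw) α)⁻¹ ^ m) ∧
      -- (a₂) the shell group
      Sn = (𝓘.K n).subgroupOf (cmBorelTriple L 3 v).M ∧ IsCompact (Sn : Set ↥(cmBorelTriple L 3 v).M) ∧
      (∀ s ∈ Sn, (s : ↥(unitaryGroupOfForm (conjLocal L (IsCMField.complexConj L) v) (cmLocalForm L 3 v))) ∈ 𝓘.K n) ∧
      (∀ k ∈ S', ∃ s ∈ Sn,
        endoEmbLocal L v ((k.1 : ↥(unitaryGroupOfForm (conjLocal L (IsCMField.complexConj L) v) (cmLocalForm L 2 v))), k.2) =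
          ((s : ↥(cmBorelTriple L 3 v).M) : ↥(unitaryGroupOfForm (conjLocal L (IsCMField.complexConj L) v) (cmLocalForm L 3 v)))) ∧
      -- (c) the cover (★ `exists_cosetCover` ①②③④ verbatim)
      (∀ u ∈ F, ∃ t ∈ b' • (Sn : Set ↥(cmBorelTriple L 3 v).M),
        (t : ↥(unitaryGroupOfForm (conjLocal L (IsCMField.complexConj L) v) (cmLocalForm L 3 v))) =
          endoEmbLocal L v ((u.1 : ↥(unitaryGroupOfForm (conjLocal L (IsCMField.complexConj L) v) (cmLocalForm L 2 v))), u.2)) ∧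
      (↑F : Set (↥(cmBorelTriple L 2 v).M ×
        (cmDatum L 1 (Matrix.of fun i j : Fin 1 => if i.val + j.val + 1 = 1 then (1 : L) else 0)).Local v)).PairwiseDisjoint
          (fun u => u • (S' : Set (↥(cmBorelTriple L 2 v).M ×
            (cmDatum L 1 (Matrix.of fun i j : Fin 1 => if i.val + j.val + 1 = 1 then (1 : L) else 0)).Local v))) ∧
      (fun x : ↥(cmBorelTriple L 2 v).M ×
          (cmDatum L 1 (Matrix.of fun i j : Fin 1 => if i.val + j.val + 1 = 1 then (1 : L) else 0)).Local v =>
        endoEmbLocal L v ((x.1 : ↥(unitaryGroupOfForm (conjLocal L (IsCMField.complexConj L) v) (cmLocalForm L 2 v))), x.2)) ⁻¹'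
          (Subtype.val '' (b' • (Sn : Set ↥(cmBorelTriple L 3 v).M))) =
        ⋃ u ∈ F, u • (S' : Set (↥(cmBorelTriple L 2 v).M ×
            (cmDatum L 1 (Matrix.of fun i j : Fin 1 => if i.val + j.val + 1 = 1 then (1 : L) else 0)).Local v)) ∧
      ∀ (x : ↥(cmBorelTriple L 2 v).M ×
          (cmDatum L 1 (Matrix.of fun i j : Fin 1 => if i.val + j.val + 1 = 1 then (1 : L) else 0)).Local v)
        (t : ↥(cmBorelTriple L 3 v).M),
        (t : ↥(unitaryGroupOfForm (conjLocal L (IsCMField.complexConj L) v) (cmLocalForm L 3 v))) =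
          endoEmbLocal L v ((x.1 : ↥(unitaryGroupOfForm (conjLocal L (IsCMField.complexConj L) v) (cmLocalForm L 2 v))), x.2) →
        (t ∈ b' • (Sn : Set ↥(cmBorelTriple L 3 v).M) ↔
          ∃ u ∈ F, x ∈ u • (S' : Set (↥(cmBorelTriple L 2 v).M ×
            (cmDatum L 1 (Matrix.of fun i j : Fin 1 => if i.val + j.val + 1 = 1 then (1 : L) else 0)).Local v))) := by
  obtain ⟨w₀, b', hw₀, hw₀K₀, hw₀n, hb', hE₃⟩ := exists_flipBase L v w hw hns 𝓘 K₀ hKK₀ hK₀ hz ha m hbM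
  have hSnc := isCompact_shellGroup L v (𝓘.K n) (𝓘.isCompact_K n)
  have hΨ := hPsi_of_pick L v (𝓘.K n) S' hpick
  obtain ⟨F, h₁, h₂, h₃, h₄⟩ := F0P3cStCharTSCosetCover.exists_cosetCover L v ((𝓘.K n).subgroupOf (cmBorelTriple L 3 v).M) hSnc b' S' hS' hΨ
  refine ⟨w₀, b', (𝓘.K n).subgroupOf (cmBorelTriple L 3 v).M, F, hw₀, hw₀K₀, hw₀n, hb', hE₃, ?_, rfl, hSnc, fun s hs => Subgroup.mem_subgroupOf.1 hs, hΨ, h₁, h₂, h₃, h₄⟩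
  -- `|β αᵐ| < |β (σα)⁻ᵐ|`: `|α| < 1 < |(σα)⁻¹|`, `m ≥ 1`, `|β| = 1`
  have hσ : Valued.v (galAdicCompletionMap (L := L) (IsCMField.complexConj L) hw α) = Valued.v α := by simp only [valued_galAdicCompletionMap]
  have hαm : Valued.v (α ^ m) < 1 := by
    rw [map_pow]; exact pow_lt_one₀ zero_le hα1 (by omega)
  have hσm : 1 < Valued.v (((galAdicCompletionMap (L := L) (IsCMField.complexConj L) hw) α)⁻¹ ^ m) := by
    rw [map_pow, map_inv₀, hσ]
    exact one_lt_pow₀ (one_lt_inv₀ ((Valuation.pos_iff _).2 hα0) |>.2 hα1) (by omega)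
  rw [map_mul, map_mul, hβ, one_mul, one_mul]
  exact hαm.trans hσm

end Summit.HodgeConjecture.HodgeConjecture.Cruxes.H413.F0P3cStCharTSXIGData

end
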